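import Summits.QuantumFields.YangMills.Theorems.BalabanUVNodesN27SpineBodyBFree13CoPH
import Summits.QuantumFields.YangMills.Theorems.BalabanUVNodesN27AtKernelPinnedReading13CoPHFSC
import Summits.QuantumFields.YangMills.Theorems.BalabanUVNodesN16PinnedLayer13CoPH
import Summits.QuantumFields.YangMills.Theorems.BalabanUVNodesN14SourceTowerOfRecord
import Summits.QuantumFields.YangMills.Theorems.BalabanUVNodesN15FullPropagatorSizedRecord

/-!
# ★ APᴮ — THIS LINEAGE's ALL-PINS STOREY AP (`…N27AtAllPinsOfRecord13CoPHVCutFSC`, p605269) RE-CONCLUDED IN THE (B)-FREE SPINE BODY CURRENCY (FILE 1 `…N27SpineBodyBFree13CoPH`):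
# the K5 slots at the per-tuple-cut physical-volume spine reading of record `crOfRecord₁₃VAt K₀ (jc …) sh`, the rates read off a reading carrying the node-U3 pin (§1) or ALL FOUR pins
# of the skeleton of record (§2; K3 v5 941dddb108cbaacf = v6 981b468a15e383a3 §0–§2, the pins UNCHANGED by rev 28), the `ForSmallCouplings`-guarded rows `hrows` ∕ `h19` **(B)-FREE**
# (plan k3v6 §1V's `…BFree` SHAPES, spelled) — so that ONE storey serves K3⁷'s display, K3⁸'s display `SpineGivenEndpointR13SepCoPHV` AT EVERY VERSION SLOT (rev 28, recipe (δⱽ);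
# FILE 1 §3 `forall_revision₁₃_hybridNE7Under_of_bodyBFree`) and the old `Spine (IsRecordOfRecord₁₃CCoPHOn Rg)` (FILE 1 §2)
# (cell `pub-ymgap`, HUMAN RULING D-0062 Track A, R134 seat `pub-ymgap-dag-n27-c` (N27 B5 composite, s2) gen 15, HOME trigger (t3⁗) «plan K3 v6 ∕ rev 28»; `--kind proof --supports
# stmt-QuantumFields-20544 --as helper`; COUNT-NEUTRAL; THEOREMS ONLY, 0 `def`, 0 `sorry`; `N`-generic, `K₀`-generic, regime-generic; NO Theses import)

WHAT IS KERNEL-CHECKED ([bookkeeping]; AP's statements with the `(B) → EndpointExistence →` prefix of `hrows` ∕ `h19` DROPPED and the conclusion the body at every guarded admissible tuple of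
`Rg`; proofs = AP's, re-threaded through FILE 1 §4 `bodyBFree₁₃CoPH_at_crOfRecord₁₃VAt_cut_of_keyedFacesP_bFree`; generator `pub-ymgap-dag-n27-c/lean/g15-drafts/genAPB.py`).
* §0 ★★ `bodyBFree₁₃CoPH_of_kernels_pin_bFree` ((Kꜰ)ᴮ: dag-n27-w1's `hybridNE7Under_of_kernels_pin_fsc` p602540 in the body currency at ANY spine reading `cr` — the leaves' off-live side).
* §1 ★★ `bodyBFree₁₃CoPH_of_kernels_pin_at_crOfRecord₁₃VAt_cut` (node-U3 pin + spine pin; `hrates := hrows.mono ((Kꜰ) §1 pHolderD4Body_rateCarriers_of_kernels_pin)`) ·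
  ★★ `bodyBFree₁₃CoPH_of_kernels_pin_at_crOfRecord₁₃VAt_cut_of_letters` (U3 rows ⟸ def-W1's four finite-volume kernel letters, (Kᴸ) §1).
* §2 ★★★ `bodyBFree₁₃CoPH_of_v5pins_at_crOfRecord₁₃VAt_cut_of_letters` — ALL FOUR READING PINS + the spine pin; the reading-layer binder DISCHARGED (`n14At_rateCarriersOfRecord₁₃CoPH_of_pinned`,
  `n15At_fullGSizedObjects_family`, `rateCarriers_ne3_of_pinnedLoose` + `h16`).
The live-line editions (AP §3) are `Rg := G ∧ LiveSel`, `hsel := fun _ _ _ hRg _ ↦ ⟨_, hRg.2⟩` — instantiated by the leaves, not restated.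

HONEST FRAMING.  COMPOSITE-node bookkeeping BY NAME; NOT a discharge: every displayed row (the pins' readings are free letters `𝔯 ksel ℓ s ℓ₃ B jc sh β`; `h16`; def-W1's kernel letters —
Bałaban-type SHAPES NOT PRINTED as such for d = 4; `Signs ∕ κ ∕ cr ∕ ρ`; `hsel hζm`; keyed N20 ∕ N21 witnesses; the (B)-free N19′ face) is a HYPOTHESIS inhabited for no family today (K0⁷
OPEN) or a decided MODEL behind a pin (dag-n14-w1's «budget only» tower; dag-n15-a's sized genuine objects); nothing of Bałaban's asserted or instantiated; (5.10), NE-estimates NOT proved;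
N14 ∕ N15 ∕ N16 ∕ N18 ∕ N19 ∕ N20 ∕ N21 ∕ N22 ∕ N27 NOT discharged; K3⁷ 20544 ASIDE, K3⁸ `SpineGivenEndpointR13SepCoPHV` = stmt-QuantumFields-27366 OPEN and NOT claimed (rev 28∕29; v1.1 docstring note); the plan's skeletons untouched; counts UNMOVED (typed 28∕28 · discharged 5∕27,
A 5∕28); one finite four-torus programme at fixed `ε` — NOT ℝ⁴, NOT infinite volume, NOT OS, NOT a mass gap, NOT Clay.  No decl below carries a cite tag.
-/

set_option autoImplicit false

namespace Summit.QuantumFields.YangMills.Theorems.BalabanUVNodesN27SpineRecord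

open scoped BigOperators Matrix.Norms.L2Operator
open Literature.MathematicalPhysics.QuantumFieldTheory.Balaban1983to89
open Literature.MathematicalPhysics.QuantumFieldTheory.Balaban1983to89.T4Continuum
open Literature.MathematicalPhysics.QuantumFieldTheory.Balaban1983to89.Node00
open Literature.MathematicalPhysics.QuantumFieldTheory.Balaban1983to89.B12Sec2to5 (betaPrime510)
open Literature.MathematicalPhysics.QuantumFieldTheory.Balaban1983to89.Node00.U3OfKernels (objectsOfRecord₁₃ KernelDecayOfRecord₁₃)
open Literature.MathematicalPhysics.QuantumFieldTheory.Balaban1983to89.Node00.U3KernelLetters (PolLimitsExistOfRecord₁₃ WindowedNE9OfRecord₁₃ WindowedDecayOfRecord₁₃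
  WindowedStepRateOfRecord₁₃)
open T4WeightBudget (RelWeightBound)
open T4IndicatorShell (ShellWeightBound)
open T4ContinuumYM4Torus (ForSmallCouplings)
open T4ApexHybrid (StringwiseHybridNE7)
open Summit.QuantumFields.BalabanUV.T4Continuum.Spine
open YMDAG.UVSplit
open Summit.QuantumFields.BalabanUV.T4Continuum.MinimalActionRate (sfClass)
open Summit.QuantumFields.YangMills.BalabanUVNodes.N19TargetClassWeightsE1Keyed
open Summit.QuantumFields.YangMills.BalabanUVNodes.N16HolderDefs (N16HolderAt)
open Summit.QuantumFields.YangMills.BalabanUVNodes.SpineRatesHolder (RatesHolderAt)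
open YMDAG.N14.TopBorn (Ne1PinnedOfRecord n14At_rateCarriersOfRecord₁₃CoPH_of_pinned)
open Summit.QuantumFields.YangMills.BalabanUVNodes.N15.GenuineRecord (fullGSizedObjects n15At_fullGSizedObjects_family)
open Summit.QuantumFields.YangMills.BalabanUVNodes.N15.AtKeyedHome (neZero_blockFactor)
open Summit.QuantumFields.YangMills.BalabanUVNodes.N16PinnedLayer13CoPH (N16PinnedLoose rateCarriers_ne3_of_pinnedLoose)

variable {N : ℕ} [NeZero N]

/-! ## §0 (Kꜰ)ᴮ: the body per guarded admissible tuple from a KERNEL-PINNED reading at ANY spine reading `cr` (the leaves' off-live side) -/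

section KernelPinnedBFree


variable (cr : (F : T4Family) → (θ : Stage13HParams F N) → θ.Provisos₁₃CoPH F N → (ℕ → ℝ) → List (ULoop F) → SpineCarriers) (𝔯 : RateReading₁₃CoPH N)
  (ksel : (F : T4Family) → (θ : Stage13HParams F N) → θ.Provisos₁₃CoPH F N → (ℕ → ℝ) → List (ULoop F) → ℕ)
  (G : ∀ {F : T4Family}, Stage13HParams F N → Prop) (ℓ : (F : T4Family) → Stage13HParams F N → U3Letters₁₁) (s : (F : T4Family) → Stage13HParams F N → ℕ) (β : ℝ)
  (hpin : ∀ (F : T4Family) (θ : Stage13HParams F N) (hP : θ.Provisos₁₃CoPH F N) (g₀ : ℕ → ℝ) (os : List (ULoop F)),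
    (𝔯.lit F θ hP g₀ os).u3 = objectsOfRecord₁₃ F N θ.toStage13Params (ℓ F θ))
  -- THE THREE READING-LAYER ROWS AT THE SELECTOR, IN v4's FULL-PREFIX KEYING (tuned sequences under (B) ∧ END only)
  (hrows : ∀ (F : T4Family) (θ : Stage13HParams F N) (hP : θ.Provisos₁₃CoPH F N), G θ → θ.Admissible F N →
      ForSmallCouplings (datumOfRecord₁₃CoPH F N θ hP) fun g₀ => ∀ os : List (ULoop F),
        N14At (𝔯.ne1 F θ hP g₀ os) ∧ N15At (ne2OfRecord₁₁ ((𝔯.lit F θ hP g₀ os).ne2 (ksel F θ hP g₀ os))) ∧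
          N16HolderAt (ne3OfRecord₁₁ F ((𝔯.lit F θ hP g₀ os).ne3 (ksel F θ hP g₀ os))) β)
  -- letter rows of the U3 letter block, per guarded tuple
  (hs : ∀ (F : T4Family) (θ : Stage13HParams F N), θ.Provisos₁₃CoPH F N → G θ → θ.Admissible F N → (ℓ F θ).Signs)
  (hκ : ∀ (F : T4Family) (θ : Stage13HParams F N), θ.Provisos₁₃CoPH F N → G θ → θ.Admissible F N → 0 < (ℓ F θ).κ)
  (hcr : ∀ (F : T4Family) (θ : Stage13HParams F N), θ.Provisos₁₃CoPH F N → G θ → θ.Admissible F N → betaPrime510 4 1 (ℓ F θ).κ ≤ (ℓ F θ).cr)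
  (hρ : ∀ (F : T4Family) (θ : Stage13HParams F N), θ.Provisos₁₃CoPH F N → G θ → θ.Admissible F N → 0 ≤ (ℓ F θ).ρ ∧ (ℓ F θ).ρ < 1)
  -- K5 (∀-keyed, as v4's `KeyedRelWeight ∕ KeyedShellWeight`), the N19′ face under the prefix at the spelled `PHolderD4 β`, the spine-side representation
  (h20 : ∀ (F : T4Family) (θ : Stage13HParams F N) (hP : θ.Provisos₁₃CoPH F N), G θ → θ.Admissible F N → ∀ (g₀ : ℕ → ℝ) (os : List (ULoop F)),
    RelWeightBound (cr F θ hP g₀ os).l₀ (cr F θ hP g₀ os).T (cr F θ hP g₀ os).A (cr F θ hP g₀ os).B (cr F θ hP g₀ os).Bad (cr F θ hP g₀ os).W)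
  (h21 : ∀ (F : T4Family) (θ : Stage13HParams F N) (hP : θ.Provisos₁₃CoPH F N), G θ → θ.Admissible F N → ∀ (g₀ : ℕ → ℝ) (os : List (ULoop F)),
    ShellWeightBound (cr F θ hP g₀ os).l₀ (cr F θ hP g₀ os).T (cr F θ hP g₀ os).A (cr F θ hP g₀ os).B (cr F θ hP g₀ os).shA (cr F θ hP g₀ os).shB (cr F θ hP g₀ os).Wsh)
  (h19 : ∀ (F : T4Family) (θ : Stage13HParams F N) (hP : θ.Provisos₁₃CoPH F N), G θ → θ.Admissible F N →
      ForSmallCouplings (datumOfRecord₁₃CoPH F N θ hP) fun g₀ => ∀ os : List (ULoop F),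
        (RatesHolderAt (datumOfRecord₁₃CoPH F N θ hP) (rateCarriersOfRecord₁₃CoPH 𝔯 F θ hP g₀ os (ksel F θ hP g₀ os)) β ∧
            ReadOutAt (datumOfRecord₁₃CoPH F N θ hP) (rateCarriersOfRecord₁₃CoPH 𝔯 F θ hP g₀ os (ksel F θ hP g₀ os)).u3 ∧
            (0 ≤ (rateCarriersOfRecord₁₃CoPH 𝔯 F θ hP g₀ os (ksel F θ hP g₀ os)).u3.ρ ∧ (rateCarriersOfRecord₁₃CoPH 𝔯 F θ hP g₀ os (ksel F θ hP g₀ os)).u3.ρ < 1)) →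
          letI := (cr F θ hP g₀ os).dec
          ∃ δ : ℕ → ℝ, NE7.Core (cr F θ hP g₀ os).l₀ (cr F θ hP g₀ os).vol (cr F θ hP g₀ os).T (cr F θ hP g₀ os).Bad
            (fun K t τ => (cr F θ hP g₀ os).A K t τ - (cr F θ hP g₀ os).shA K t τ) (fun K t τ => (cr F θ hP g₀ os).B K t τ - (cr F θ hP g₀ os).shB K t τ) δ ∧
            Summable δ)
  (hx : ∀ (F : T4Family) (θ : Stage13HParams F N) (hP : θ.Provisos₁₃CoPH F N), G θ → θ.Admissible F N →
      ForSmallCouplings (datumOfRecord₁₃CoPH F N θ hP) fun g₀ => ∀ os : List (ULoop F),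
        0 < (cr F θ hP g₀ os).l₀ ∧ 0 < (cr F θ hP g₀ os).vol ∧
        (∀ (K : ℕ) (t : ℝ), |t| ≤ (cr F θ hP g₀ os).l₀ →
          T4GenFunBounds.schemeZ ((datumOfRecord₁₃CoPH F N θ hP).scheme g₀) os ((cr F θ hP g₀ os).K₀ + K) t =
            ∑ τ ∈ (cr F θ hP g₀ os).T K, (cr F θ hP g₀ os).A K t τ) ∧
        (∀ (K : ℕ) (t : ℝ), |t| ≤ (cr F θ hP g₀ os).l₀ →
          T4GenFunBounds.schemeZ ((datumOfRecord₁₃CoPH F N θ hP).scheme g₀) os ((cr F θ hP g₀ os).K₀ + K + 1) t =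
            ∑ τ ∈ (cr F θ hP g₀ os).T K, (cr F θ hP g₀ os).B K t τ))
include hpin hrows hs hκ hcr hρ h20 h21 h19 hx

/-- ★★ **(Kꜰ)ᴮ — THE (B)-FREE SPINE BODY AT EVERY GUARDED ADMISSIBLE TUPLE FROM A KERNEL-PINNED READING, ANY SPINE READING `cr`** = dag-n27-w1's (Kꜰ) `hybridNE7Under_of_kernels_pin_fsc`
(`…N27AtKernelPinnedReading13CoPHFSC`, p602540) IN THE BODY CURRENCY, argument for argument: `hrows` ∕ `h19` ∕ `hx` `ForSmallCouplings`-guarded and (B)-FREE, conclusion the body (FILE 1 §2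
`bodyBFree₁₃CoPH_of_keyedFacesP_bFree` at `rr :=` the bundle of record at the selector, `P := PHolderD4 β` spelled, `hrates := hrows.mono ((Kꜰ) §1 pHolderD4Body_rateCarriers_of_kernels_pin)` with the
tuple-level kernel rows `hdec h18 h22`).  The leaves' OFF-LIVE side at a free `cr'`.  NOT a discharge; no stub closed; dag-n27-w1's (Kꜰ) stands (this is its image, re-home on their word). [bookkeeping] -/
theorem bodyBFree₁₃CoPH_of_kernels_pin_bFree
    (hdec : ∀ (F : T4Family) (θ : Stage13HParams F N), θ.Provisos₁₃CoPH F N → G θ → θ.Admissible F N → KernelDecayOfRecord₁₃ F N θ.toStage13Params 0 1 (ℓ F θ).κ)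
    (h18 : ∀ (F : T4Family) (θ : Stage13HParams F N), θ.Provisos₁₃CoPH F N → G θ → θ.Admissible F N → ∀ k : ℕ,
      N18At (u3OfRecord₁₃ θ.toStage13Params (objectsOfRecord₁₃ F N θ.toStage13Params (ℓ F θ)) k))
    (h22 : ∀ (F : T4Family) (θ : Stage13HParams F N), θ.Provisos₁₃CoPH F N → G θ → θ.Admissible F N → ∀ k : ℕ,
      N22At (u3OfRecord₁₃ θ.toStage13Params (objectsOfRecord₁₃ F N θ.toStage13Params (ℓ F θ)) k))
    (F : T4Family) (θ : Stage13HParams F N) (hP : θ.Provisos₁₃CoPH F N) (hG : G θ) (hθ : θ.Admissible F N) :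
    ForSmallCouplings (datumOfRecord₁₃CoPH F N θ hP) fun g₀ => StringwiseHybridNE7 ((datumOfRecord₁₃CoPH F N θ hP).scheme g₀) :=
  bodyBFree₁₃CoPH_of_keyedFacesP_bFree cr (fun F θ hP g₀ os => rateCarriersOfRecord₁₃CoPH 𝔯 F θ hP g₀ os (ksel F θ hP g₀ os)) (fun _ θ => G θ)
    (fun D R => RatesHolderAt D R β ∧ ReadOutAt D R.u3 ∧ (0 ≤ R.u3.ρ ∧ R.u3.ρ < 1)) h20 h21
    (fun F θ hP hG hθ => (hrows F θ hP hG hθ).mono fun g₀ h os =>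
      pHolderD4Body_rateCarriers_of_kernels_pin 𝔯 θ hP g₀ os (ℓ F θ) (hpin F θ hP g₀ os) β (ksel F θ hP g₀ os) (h os).1 (h os).2.1 (h os).2.2
        (hs F θ hP hG hθ) (hκ F θ hP hG hθ) (hcr F θ hP hG hθ) (hρ F θ hP hG hθ) (hdec F θ hP hG hθ) (h18 F θ hP hG hθ _) (h22 F θ hP hG hθ _))
    h19 hx F θ hP hG hθ

end KernelPinnedBFree

variable (K₀ : ℕ)
  (jc : (F : T4Family) → (θ : Stage13HParams F N) → θ.Provisos₁₃CoPH F N → (ℕ → ℝ) → List (ULoop F) → ℕ → ℕ)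
  (sh : ShellSplit₁₃CoPH N K₀) (β : ℝ) (𝔯 : RateReading₁₃CoPH N)
  (ksel : (F : T4Family) → (θ : Stage13HParams F N) → θ.Provisos₁₃CoPH F N → (ℕ → ℝ) → List (ULoop F) → ℕ)
  (ℓ : (F : T4Family) → Stage13HParams F N → U3Letters₁₁) (s : (F : T4Family) → Stage13HParams F N → ℕ)
  (ℓ₃ : T4Family → NE3Letters₁₁) (B : T4Family → ℝ)

/-! ## §1 The node-U3 pin + the spine pin, any regime (`hsel` per tuple): reading-layer rows, rates and N19′ edge `ForSmallCouplings`-guarded and (B)-FREE, concluded in the body -/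

/-- ★★ **THE (B)-FREE SPINE BODY ON A REGIME WITH THE NODE-U3 PIN AND THE SPINE PIN** = AP §1 `spine_rec13CCoPHOn_of_kernels_pin_fsc_at_crOfRecord₁₃VAt_cut` (p605269) IN THE BODY CURRENCY:
the reading-layer binder `hrows` and the N19′ face `h19` are `ForSmallCouplings`-guarded but **(B)-FREE** (their `(B) → EndpointExistence →` prefix DROPPED — plan k3v6 §1V's `…BFree`
shapes), everything else VERBATIM (`hpin`, `hs hκ hcr hρ hdec h18 h22`, `hsel hζm`, keyed N20 ∕ N21 witnesses); UC4ᴮ `bodyBFree₁₃CoPH_at_crOfRecord₁₃VAt_cut_of_keyedFacesP_bFree` with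
`hrates := hrows.mono ((Kꜰ) §1 pHolderD4Body_rateCarriers_of_kernels_pin)` ⇒ the body at every guarded admissible tuple of `Rg` — hence (FILE 1 §2∕§3) the old `Spine (IsRecordOfRecord₁₃CCoPHOn Rg)`,
K3⁷'s display AND K3⁸'s display at every version slot.  Every displayed antecedent a HYPOTHESIS (0∕1 today); (5.10) NOT proved. [bookkeeping] -/
theorem bodyBFree₁₃CoPH_of_kernels_pin_at_crOfRecord₁₃VAt_cut (Rg : (F : T4Family) → Stage13HParams F N → Prop)
    (hpin : ∀ (F : T4Family) (θ : Stage13HParams F N) (hP : θ.Provisos₁₃CoPH F N) (g₀ : ℕ → ℝ) (os : List (ULoop F)),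
      (𝔯.lit F θ hP g₀ os).u3 = objectsOfRecord₁₃ F N θ.toStage13Params (ℓ F θ))
    (hrows : ∀ (F : T4Family) (θ : Stage13HParams F N) (hP : θ.Provisos₁₃CoPH F N), Rg F θ → θ.Admissible F N →
        ForSmallCouplings (datumOfRecord₁₃CoPH F N θ hP) fun g₀ => ∀ os : List (ULoop F),
          N14At (𝔯.ne1 F θ hP g₀ os) ∧ N15At (ne2OfRecord₁₁ ((𝔯.lit F θ hP g₀ os).ne2 (ksel F θ hP g₀ os))) ∧
            N16HolderAt (ne3OfRecord₁₁ F ((𝔯.lit F θ hP g₀ os).ne3 (ksel F θ hP g₀ os))) β)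
    (hs : ∀ (F : T4Family) (θ : Stage13HParams F N), θ.Provisos₁₃CoPH F N → Rg F θ → θ.Admissible F N → (ℓ F θ).Signs)
    (hκ : ∀ (F : T4Family) (θ : Stage13HParams F N), θ.Provisos₁₃CoPH F N → Rg F θ → θ.Admissible F N → 0 < (ℓ F θ).κ)
    (hcr : ∀ (F : T4Family) (θ : Stage13HParams F N), θ.Provisos₁₃CoPH F N → Rg F θ → θ.Admissible F N →
      betaPrime510 4 1 (ℓ F θ).κ ≤ (ℓ F θ).cr)
    (hρ : ∀ (F : T4Family) (θ : Stage13HParams F N), θ.Provisos₁₃CoPH F N → Rg F θ → θ.Admissible F N →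
      0 ≤ (ℓ F θ).ρ ∧ (ℓ F θ).ρ < 1)
    (hdec : ∀ (F : T4Family) (θ : Stage13HParams F N), θ.Provisos₁₃CoPH F N → Rg F θ → θ.Admissible F N →
      KernelDecayOfRecord₁₃ F N θ.toStage13Params 0 1 (ℓ F θ).κ)
    (h18 : ∀ (F : T4Family) (θ : Stage13HParams F N), θ.Provisos₁₃CoPH F N → Rg F θ → θ.Admissible F N →
      ∀ k : ℕ, N18At (u3OfRecord₁₃ θ.toStage13Params (objectsOfRecord₁₃ F N θ.toStage13Params (ℓ F θ)) k))
    (h22 : ∀ (F : T4Family) (θ : Stage13HParams F N), θ.Provisos₁₃CoPH F N → Rg F θ → θ.Admissible F N →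
      ∀ k : ℕ, N22At (u3OfRecord₁₃ θ.toStage13Params (objectsOfRecord₁₃ F N θ.toStage13Params (ℓ F θ)) k))
    (hsel : ∀ (F : T4Family) (θ : Stage13HParams F N), θ.Provisos₁₃CoPH F N → Rg F θ → θ.Admissible F N →
      ∃ E : B12.RunParams → ℝ, θ.ppSel = ppSelLiveOfRecord F N θ.ν θ.τ9 E (wOfRecord₉ F N θ.toStage9Params))
    (hζm : ∀ (F : T4Family) (θ : Stage13HParams F N), θ.Provisos₁₃CoPH F N → Rg F θ → θ.Admissible F N → ZetaMeasurable F N θ.ζ)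
    (h20 : ∀ (F : T4Family) (θ : Stage13HParams F N) (hP : θ.Provisos₁₃CoPH F N), Rg F θ → θ.Admissible F N →
      ∀ (g₀ : ℕ → ℝ) (os : List (ULoop F)),
        ∃ W : ℕ → ℝ, RelWeightBound 1 (classSet₁₃ θ K₀ g₀) (weightA₁₃ θ hP K₀ g₀ os) (weightB₁₃ θ hP K₀ g₀ os) (badClass₁₃ θ K₀ g₀ (jc F θ hP g₀ os)) W)
    (h21 : ∀ (F : T4Family) (θ : Stage13HParams F N) (hP : θ.Provisos₁₃CoPH F N), Rg F θ → θ.Admissible F N →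
      ∀ (g₀ : ℕ → ℝ) (os : List (ULoop F)),
        ∃ Wsh : ℕ → ℝ, ShellWeightBound 1 (classSet₁₃ θ K₀ g₀) (weightA₁₃ θ hP K₀ g₀ os) (weightB₁₃ θ hP K₀ g₀ os) (sh F θ hP g₀ os).1 (sh F θ hP g₀ os).2 Wsh)
    (h19 : ∀ (F : T4Family) (θ : Stage13HParams F N) (hP : θ.Provisos₁₃CoPH F N), Rg F θ → θ.Admissible F N →
        ForSmallCouplings (datumOfRecord₁₃CoPH F N θ hP) fun g₀ => ∀ os : List (ULoop F),
          (RatesHolderAt (datumOfRecord₁₃CoPH F N θ hP) (rateCarriersOfRecord₁₃CoPH 𝔯 F θ hP g₀ os (ksel F θ hP g₀ os)) β ∧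
              ReadOutAt (datumOfRecord₁₃CoPH F N θ hP) (rateCarriersOfRecord₁₃CoPH 𝔯 F θ hP g₀ os (ksel F θ hP g₀ os)).u3 ∧
              (0 ≤ (rateCarriersOfRecord₁₃CoPH 𝔯 F θ hP g₀ os (ksel F θ hP g₀ os)).u3.ρ ∧
                (rateCarriersOfRecord₁₃CoPH 𝔯 F θ hP g₀ os (ksel F θ hP g₀ os)).u3.ρ < 1)) →
            letI : DecidableEq (Σ K, SiteSeqKey F (K₀ + K)) := Classical.decEq _
            ∃ δ : ℕ → ℝ, NE7.Core 1 (F.side ^ 4) (classSet₁₃ θ K₀ g₀) (badClass₁₃ θ K₀ g₀ (jc F θ hP g₀ os))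
              (fun K t x => weightA₁₃ θ hP K₀ g₀ os K t x - (sh F θ hP g₀ os).1 K t x)
              (fun K t x => weightB₁₃ θ hP K₀ g₀ os K t x - (sh F θ hP g₀ os).2 K t x) δ ∧ Summable δ)
    (F : T4Family) (θ : Stage13HParams F N) (hP : θ.Provisos₁₃CoPH F N) (hRg : Rg F θ) (hθ : θ.Admissible F N) :
    ForSmallCouplings (datumOfRecord₁₃CoPH F N θ hP) fun g₀ => StringwiseHybridNE7 ((datumOfRecord₁₃CoPH F N θ hP).scheme g₀) :=
  bodyBFree₁₃CoPH_at_crOfRecord₁₃VAt_cut_of_keyedFacesP_bFree K₀ jc sh Rg (fun F θ hP g₀ os => rateCarriersOfRecord₁₃CoPH 𝔯 F θ hP g₀ os (ksel F θ hP g₀ os))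
    (fun D R => RatesHolderAt D R β ∧ ReadOutAt D R.u3 ∧ (0 ≤ R.u3.ρ ∧ R.u3.ρ < 1)) hsel hζm h20 h21
    (fun F θ hP hRg hθ => (hrows F θ hP hRg hθ).mono fun g₀ h os =>
      pHolderD4Body_rateCarriers_of_kernels_pin 𝔯 θ hP g₀ os (ℓ F θ) (hpin F θ hP g₀ os) β (ksel F θ hP g₀ os) (h os).1 (h os).2.1 (h os).2.2
        (hs F θ hP hRg hθ) (hκ F θ hP hRg hθ) (hcr F θ hP hRg hθ) (hρ F θ hP hRg hθ) (hdec F θ hP hRg hθ) (h18 F θ hP hRg hθ _) (h22 F θ hP hRg hθ _))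
    h19 F θ hP hRg hθ

/-- ★★ **THE SAME WITH THE U3 ROWS READ OFF def-W1's FOUR FINITE-VOLUME KERNEL LETTERS OF RECORD** ((Kᴸ) §1 `kernelDecayOfRecord₁₃_of_letters_guarded` ∕ `n18At_∕n22At_kernels_of_letters_guarded`),
= AP §1-letters in the body currency.  NOT a discharge. [bookkeeping] -/
theorem bodyBFree₁₃CoPH_of_kernels_pin_at_crOfRecord₁₃VAt_cut_of_letters (Rg : (F : T4Family) → Stage13HParams F N → Prop)
    (hpin : ∀ (F : T4Family) (θ : Stage13HParams F N) (hP : θ.Provisos₁₃CoPH F N) (g₀ : ℕ → ℝ) (os : List (ULoop F)),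
      (𝔯.lit F θ hP g₀ os).u3 = objectsOfRecord₁₃ F N θ.toStage13Params (ℓ F θ))
    (hrows : ∀ (F : T4Family) (θ : Stage13HParams F N) (hP : θ.Provisos₁₃CoPH F N), Rg F θ → θ.Admissible F N →
        ForSmallCouplings (datumOfRecord₁₃CoPH F N θ hP) fun g₀ => ∀ os : List (ULoop F),
          N14At (𝔯.ne1 F θ hP g₀ os) ∧ N15At (ne2OfRecord₁₁ ((𝔯.lit F θ hP g₀ os).ne2 (ksel F θ hP g₀ os))) ∧
            N16HolderAt (ne3OfRecord₁₁ F ((𝔯.lit F θ hP g₀ os).ne3 (ksel F θ hP g₀ os))) β)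
    (hs : ∀ (F : T4Family) (θ : Stage13HParams F N), θ.Provisos₁₃CoPH F N → Rg F θ → θ.Admissible F N → (ℓ F θ).Signs)
    (hκ : ∀ (F : T4Family) (θ : Stage13HParams F N), θ.Provisos₁₃CoPH F N → Rg F θ → θ.Admissible F N → 0 < (ℓ F θ).κ)
    (hcr : ∀ (F : T4Family) (θ : Stage13HParams F N), θ.Provisos₁₃CoPH F N → Rg F θ → θ.Admissible F N →
      betaPrime510 4 1 (ℓ F θ).κ ≤ (ℓ F θ).cr)
    (hρ : ∀ (F : T4Family) (θ : Stage13HParams F N), θ.Provisos₁₃CoPH F N → Rg F θ → θ.Admissible F N →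
      0 ≤ (ℓ F θ).ρ ∧ (ℓ F θ).ρ < 1)
    (hL : ∀ (F : T4Family) (θ : Stage13HParams F N), θ.Provisos₁₃CoPH F N → Rg F θ → θ.Admissible F N →
      PolLimitsExistOfRecord₁₃ F N θ.toStage13Params)
    (h9 : ∀ (F : T4Family) (θ : Stage13HParams F N), θ.Provisos₁₃CoPH F N → Rg F θ → θ.Admissible F N →
      WindowedNE9OfRecord₁₃ F N θ.toStage13Params (ℓ F θ).κ (ℓ F θ).moduli)
    (hW : ∀ (F : T4Family) (θ : Stage13HParams F N), θ.Provisos₁₃CoPH F N → Rg F θ → θ.Admissible F N →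
      WindowedDecayOfRecord₁₃ F N θ.toStage13Params 0 1 (ℓ F θ).κ)
    (hS : ∀ (F : T4Family) (θ : Stage13HParams F N), θ.Provisos₁₃CoPH F N → Rg F θ → θ.Admissible F N →
      WindowedStepRateOfRecord₁₃ F N θ.toStage13Params (s F θ) (ℓ F θ).κ (ℓ F θ).θ₅ ((ℓ F θ).C₅ * (ℓ F θ).θ₅))
    (hsel : ∀ (F : T4Family) (θ : Stage13HParams F N), θ.Provisos₁₃CoPH F N → Rg F θ → θ.Admissible F N →
      ∃ E : B12.RunParams → ℝ, θ.ppSel = ppSelLiveOfRecord F N θ.ν θ.τ9 E (wOfRecord₉ F N θ.toStage9Params))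
    (hζm : ∀ (F : T4Family) (θ : Stage13HParams F N), θ.Provisos₁₃CoPH F N → Rg F θ → θ.Admissible F N → ZetaMeasurable F N θ.ζ)
    (h20 : ∀ (F : T4Family) (θ : Stage13HParams F N) (hP : θ.Provisos₁₃CoPH F N), Rg F θ → θ.Admissible F N →
      ∀ (g₀ : ℕ → ℝ) (os : List (ULoop F)),
        ∃ W : ℕ → ℝ, RelWeightBound 1 (classSet₁₃ θ K₀ g₀) (weightA₁₃ θ hP K₀ g₀ os) (weightB₁₃ θ hP K₀ g₀ os) (badClass₁₃ θ K₀ g₀ (jc F θ hP g₀ os)) W)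
    (h21 : ∀ (F : T4Family) (θ : Stage13HParams F N) (hP : θ.Provisos₁₃CoPH F N), Rg F θ → θ.Admissible F N →
      ∀ (g₀ : ℕ → ℝ) (os : List (ULoop F)),
        ∃ Wsh : ℕ → ℝ, ShellWeightBound 1 (classSet₁₃ θ K₀ g₀) (weightA₁₃ θ hP K₀ g₀ os) (weightB₁₃ θ hP K₀ g₀ os) (sh F θ hP g₀ os).1 (sh F θ hP g₀ os).2 Wsh)
    (h19 : ∀ (F : T4Family) (θ : Stage13HParams F N) (hP : θ.Provisos₁₃CoPH F N), Rg F θ → θ.Admissible F N →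
        ForSmallCouplings (datumOfRecord₁₃CoPH F N θ hP) fun g₀ => ∀ os : List (ULoop F),
          (RatesHolderAt (datumOfRecord₁₃CoPH F N θ hP) (rateCarriersOfRecord₁₃CoPH 𝔯 F θ hP g₀ os (ksel F θ hP g₀ os)) β ∧
              ReadOutAt (datumOfRecord₁₃CoPH F N θ hP) (rateCarriersOfRecord₁₃CoPH 𝔯 F θ hP g₀ os (ksel F θ hP g₀ os)).u3 ∧
              (0 ≤ (rateCarriersOfRecord₁₃CoPH 𝔯 F θ hP g₀ os (ksel F θ hP g₀ os)).u3.ρ ∧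
                (rateCarriersOfRecord₁₃CoPH 𝔯 F θ hP g₀ os (ksel F θ hP g₀ os)).u3.ρ < 1)) →
            letI : DecidableEq (Σ K, SiteSeqKey F (K₀ + K)) := Classical.decEq _
            ∃ δ : ℕ → ℝ, NE7.Core 1 (F.side ^ 4) (classSet₁₃ θ K₀ g₀) (badClass₁₃ θ K₀ g₀ (jc F θ hP g₀ os))
              (fun K t x => weightA₁₃ θ hP K₀ g₀ os K t x - (sh F θ hP g₀ os).1 K t x)
              (fun K t x => weightB₁₃ θ hP K₀ g₀ os K t x - (sh F θ hP g₀ os).2 K t x) δ ∧ Summable δ)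
    (F : T4Family) (θ : Stage13HParams F N) (hP : θ.Provisos₁₃CoPH F N) (hRg : Rg F θ) (hθ : θ.Admissible F N) :
    ForSmallCouplings (datumOfRecord₁₃CoPH F N θ hP) fun g₀ => StringwiseHybridNE7 ((datumOfRecord₁₃CoPH F N θ hP).scheme g₀) :=
  bodyBFree₁₃CoPH_of_kernels_pin_at_crOfRecord₁₃VAt_cut K₀ jc sh β 𝔯 ksel ℓ Rg hpin hrows hs hκ hcr hρ
    (kernelDecayOfRecord₁₃_of_letters_guarded Rg ℓ hL hW) (n18At_kernels_of_letters_guarded Rg ℓ s hL hS) (n22At_kernels_of_letters_guarded Rg ℓ hs hL h9)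
    hsel hζm h20 h21 h19 F θ hP hRg hθ

/-! ## §2 ALL PINS OF THE SKELETON OF RECORD (K3 v5 941dddb108cbaacf = v6 981b468a15e383a3 §0–§2: the four reading pins UNCHANGED) + the spine pin — the reading-layer binder DISCHARGED -/

/-- ★★★ **THE (B)-FREE SPINE BODY ON A REGIME FROM A READING CARRYING ALL FOUR v5∕v6 PINS, K5 AT THE PER-TUPLE-CUT SPINE READING OF RECORD** = AP §2
`spine_rec13CCoPHOn_of_v5pins_fsc_at_crOfRecord₁₃VAt_cut_of_letters` IN THE BODY CURRENCY (the reading pins `hpin1 hpin2 hpinL hpin` of `GuardedReadingN16 𝔯 ksel ℓ ℓ₃ g B` — UNCHANGED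
in k3v6 — BY NAME∕BODY; the reading-layer binder DISCHARGED behind them; the N19′ face `h19` `ForSmallCouplings`-guarded and (B)-FREE at the spelled `PHolderD4 β` = the keyed-witness form of
k3v6 §1V's `KeyedCoreEdgeHolderD4BFree β cr (rrOfRecord 𝔯 ksel)` at the pin).  The body on `Rg` then costs EXACTLY: the pins · `h16` · def-W1's four kernel letters · `Signs ∕ 0 < κ ∕
betaPrime510 4 1 κ ≤ cr ∕ 0 ≤ ρ < 1` · `hsel hζm` · keyed N20 ∕ N21 witnesses · `h19`.  Every row a HYPOTHESIS or a decided MODEL (0∕1 today); nothing of Bałaban's proved; NOT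
`stub_rates13HV` ∕ `stub_expansion13HV`; no node discharged. [bookkeeping] -/
theorem bodyBFree₁₃CoPH_of_v5pins_at_crOfRecord₁₃VAt_cut_of_letters (Rg : (F : T4Family) → Stage13HParams F N → Prop)
    (hpin1 : Ne1PinnedOfRecord 𝔯)
    (hpin2 : ∃ (b aS : ℝ) (ν μ α β' : Fin 4) (c35 p : ℝ), 0 < b ∧ 0 < aS ∧
      ∀ (F : T4Family) (θ : Stage13HParams F N) (hP : θ.Provisos₁₃CoPH F N) (g₀ : ℕ → ℝ) (os : List (ULoop F)) (k : ℕ),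
        (𝔯.lit F θ hP g₀ os).ne2 k = haveI := neZero_blockFactor F; fullGSizedObjects 3 F.hL b aS ν μ α β' c35 p)
    (hpinL : N16PinnedLoose 𝔯 ℓ₃ B)
    (hpin : ∀ (F : T4Family) (θ : Stage13HParams F N) (hP : θ.Provisos₁₃CoPH F N) (g₀ : ℕ → ℝ) (os : List (ULoop F)),
      (𝔯.lit F θ hP g₀ os).u3 = objectsOfRecord₁₃ F N θ.toStage13Params (ℓ F θ))
    (h16 : ∀ (F : T4Family), (∃ θ : Stage13HParams F N, θ.Provisos₁₃CoPH F N ∧ Rg F θ ∧ θ.Admissible F N) →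
      N16HolderAt (ne3OfRecord₁₁ F { ne3ConstLayerOfRecord₁₁ F N (ℓ₃ F) with
        dom := {V | V ∈ ne3DomOfRecord₁₁ F N 0 0 ∧ V ∈ sfClass 4 F.L (ne3NperOfRecord₁₁ F 0 0) ((ℓ₃ F).ε / B F) 0} }) β)
    (hs : ∀ (F : T4Family) (θ : Stage13HParams F N), θ.Provisos₁₃CoPH F N → Rg F θ → θ.Admissible F N → (ℓ F θ).Signs)
    (hκ : ∀ (F : T4Family) (θ : Stage13HParams F N), θ.Provisos₁₃CoPH F N → Rg F θ → θ.Admissible F N → 0 < (ℓ F θ).κ)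
    (hcr : ∀ (F : T4Family) (θ : Stage13HParams F N), θ.Provisos₁₃CoPH F N → Rg F θ → θ.Admissible F N →
      betaPrime510 4 1 (ℓ F θ).κ ≤ (ℓ F θ).cr)
    (hρ : ∀ (F : T4Family) (θ : Stage13HParams F N), θ.Provisos₁₃CoPH F N → Rg F θ → θ.Admissible F N →
      0 ≤ (ℓ F θ).ρ ∧ (ℓ F θ).ρ < 1)
    (hL : ∀ (F : T4Family) (θ : Stage13HParams F N), θ.Provisos₁₃CoPH F N → Rg F θ → θ.Admissible F N →
      PolLimitsExistOfRecord₁₃ F N θ.toStage13Params)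
    (h9 : ∀ (F : T4Family) (θ : Stage13HParams F N), θ.Provisos₁₃CoPH F N → Rg F θ → θ.Admissible F N →
      WindowedNE9OfRecord₁₃ F N θ.toStage13Params (ℓ F θ).κ (ℓ F θ).moduli)
    (hW : ∀ (F : T4Family) (θ : Stage13HParams F N), θ.Provisos₁₃CoPH F N → Rg F θ → θ.Admissible F N →
      WindowedDecayOfRecord₁₃ F N θ.toStage13Params 0 1 (ℓ F θ).κ)
    (hS : ∀ (F : T4Family) (θ : Stage13HParams F N), θ.Provisos₁₃CoPH F N → Rg F θ → θ.Admissible F N →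
      WindowedStepRateOfRecord₁₃ F N θ.toStage13Params (s F θ) (ℓ F θ).κ (ℓ F θ).θ₅ ((ℓ F θ).C₅ * (ℓ F θ).θ₅))
    (hsel : ∀ (F : T4Family) (θ : Stage13HParams F N), θ.Provisos₁₃CoPH F N → Rg F θ → θ.Admissible F N →
      ∃ E : B12.RunParams → ℝ, θ.ppSel = ppSelLiveOfRecord F N θ.ν θ.τ9 E (wOfRecord₉ F N θ.toStage9Params))
    (hζm : ∀ (F : T4Family) (θ : Stage13HParams F N), θ.Provisos₁₃CoPH F N → Rg F θ → θ.Admissible F N → ZetaMeasurable F N θ.ζ)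
    (h20 : ∀ (F : T4Family) (θ : Stage13HParams F N) (hP : θ.Provisos₁₃CoPH F N), Rg F θ → θ.Admissible F N →
      ∀ (g₀ : ℕ → ℝ) (os : List (ULoop F)),
        ∃ W : ℕ → ℝ, RelWeightBound 1 (classSet₁₃ θ K₀ g₀) (weightA₁₃ θ hP K₀ g₀ os) (weightB₁₃ θ hP K₀ g₀ os) (badClass₁₃ θ K₀ g₀ (jc F θ hP g₀ os)) W)
    (h21 : ∀ (F : T4Family) (θ : Stage13HParams F N) (hP : θ.Provisos₁₃CoPH F N), Rg F θ → θ.Admissible F N →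
      ∀ (g₀ : ℕ → ℝ) (os : List (ULoop F)),
        ∃ Wsh : ℕ → ℝ, ShellWeightBound 1 (classSet₁₃ θ K₀ g₀) (weightA₁₃ θ hP K₀ g₀ os) (weightB₁₃ θ hP K₀ g₀ os) (sh F θ hP g₀ os).1 (sh F θ hP g₀ os).2 Wsh)
    (h19 : ∀ (F : T4Family) (θ : Stage13HParams F N) (hP : θ.Provisos₁₃CoPH F N), Rg F θ → θ.Admissible F N →
        ForSmallCouplings (datumOfRecord₁₃CoPH F N θ hP) fun g₀ => ∀ os : List (ULoop F),
          (RatesHolderAt (datumOfRecord₁₃CoPH F N θ hP) (rateCarriersOfRecord₁₃CoPH 𝔯 F θ hP g₀ os (ksel F θ hP g₀ os)) β ∧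
              ReadOutAt (datumOfRecord₁₃CoPH F N θ hP) (rateCarriersOfRecord₁₃CoPH 𝔯 F θ hP g₀ os (ksel F θ hP g₀ os)).u3 ∧
              (0 ≤ (rateCarriersOfRecord₁₃CoPH 𝔯 F θ hP g₀ os (ksel F θ hP g₀ os)).u3.ρ ∧
                (rateCarriersOfRecord₁₃CoPH 𝔯 F θ hP g₀ os (ksel F θ hP g₀ os)).u3.ρ < 1)) →
            letI : DecidableEq (Σ K, SiteSeqKey F (K₀ + K)) := Classical.decEq _
            ∃ δ : ℕ → ℝ, NE7.Core 1 (F.side ^ 4) (classSet₁₃ θ K₀ g₀) (badClass₁₃ θ K₀ g₀ (jc F θ hP g₀ os))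
              (fun K t x => weightA₁₃ θ hP K₀ g₀ os K t x - (sh F θ hP g₀ os).1 K t x)
              (fun K t x => weightB₁₃ θ hP K₀ g₀ os K t x - (sh F θ hP g₀ os).2 K t x) δ ∧ Summable δ)
    (F : T4Family) (θ : Stage13HParams F N) (hP : θ.Provisos₁₃CoPH F N) (hRg : Rg F θ) (hθ : θ.Admissible F N) :
    ForSmallCouplings (datumOfRecord₁₃CoPH F N θ hP) fun g₀ => StringwiseHybridNE7 ((datumOfRecord₁₃CoPH F N θ hP).scheme g₀) :=
  bodyBFree₁₃CoPH_of_kernels_pin_at_crOfRecord₁₃VAt_cut_of_letters K₀ jc sh β 𝔯 ksel ℓ s Rg hpin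
    (fun F θ hP hRg hθ => ForSmallCouplings.of_forall fun g₀ os => by
      refine ⟨?_, ?_, ?_⟩
      · exact n14At_rateCarriersOfRecord₁₃CoPH_of_pinned 𝔯 hpin1 F θ hP g₀ os (ksel F θ hP g₀ os)
      · obtain ⟨b, aS, ν, μ, α, β', c35, p, hb, haS, h⟩ := hpin2
        rw [h F θ hP g₀ os]
        exact n15At_fullGSizedObjects_family hb haS ν μ α β' c35 p F
      · show N16HolderAt (rateCarriersOfRecord₁₃CoPH 𝔯 F θ hP g₀ os (ksel F θ hP g₀ os)).ne3 β
        rw [rateCarriers_ne3_of_pinnedLoose hpinL F θ hP g₀ os (ksel F θ hP g₀ os)]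
        exact h16 F ⟨θ, hP, hRg, hθ⟩)
    hs hκ hcr hρ hL h9 hW hS hsel hζm h20 h21 h19 F θ hP hRg hθ

end Summit.QuantumFields.YangMills.Theorems.BalabanUVNodesN27SpineRecord
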